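import Summits.QuantumFields.BalabanUV.Beta.FP.FarRegionSmearGraded
import Summits.QuantumFields.BalabanUV.Beta.FP.FarRegionMoment

/-!
# `BalabanUV.Beta.FP.FarRegionSmearShape` — road «FP» (binder row D1), `RHOA-DESIGN.md` §3 (F-PC) ∕ §5 row RHOA-4 «FAR-REGION MOMENT», PART 2 FILE C (towards (b)):
# THE UNIFORM FAR SHAPE OF A SMEARED GRADED KERNEL BEYOND THE WINDOW AND ITS n-FREE FAR SECOND MOMENT — `FarRegionSmearGraded` at `‖z‖∞ ≥ 8` + the trivial core
# `‖z‖∞ ≤ 8` ⟹ LITERALLY the hypothesis `hfar` of `FP/FarRegionMoment` (`b = 2`), chained at `a = 4` (two degree-2 legs)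
# ([folklore] real analysis on `ℤ⁴`; G-an2-4 formalisation swarm, unit `b2b-balaban-gan24-formalise-leaf-06`, gen 32, cross-lane idle-seat brick)

HONEST DEPENDENCY (page 1, mandatory): continuum YM on T⁴ ⇐ BetaPertH ∧ nine spine estimates (0/9 proved); BetaPertH ⇐ (D1) ∧ (D4) ∧
CAP+tail; G-an2-4 gates asym, D1 and NE2/3/4.  HONEST FRAMING (cell contract, verbatim): «discharging `BetaPertH` makes Bałaban's UV
stability UNCONDITIONAL — a real constructive-QFT result; it is NOT the continuum limit and NOT the Clay problem.»  THIS MODULE is elementary [folklore]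
bookkeeping over gen-32's `FarRegionSmearGraded.abs_smear_le_of_graded_far`, `FarRegionMoment.sum_far_abs_le ∕ summable_moment` and leaf-02-g6's letters; it asserts
nothing about Bałaban's objects, cites nothing, mints no `Prop` fact, has no `def`, 0 sorry.  The graded data and the vertex letters are HYPOTHESES (suppliers: IR-5∕IR-6,
H2-ASM-2, H2V — OPEN).  NOT `hbook`, NOT `ρ_n = O(1)`, NOT D1, NOT BetaPertH, NOT continuum, NOT Clay; «not in print; our bookkeeping».

CONTENT (`Θ₀ := 2·e^{δ/2}·e^{δ/2}·Zl 4 (δ/2)²`, `K₈` of `FarRegionSmearGraded`, `K₀ := Ag·C·Θ₀·8^{a+2}e^{8m}`).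
* §1 `abs_smear_le_core` (`1 ≤ ‖z‖∞ ≤ 8`: `|Σ' c·H(z+x−y)| ≤ K₀·Ψ_m(‖z‖∞)`), **`abs_smear_le_of_graded`**: for EVERY `‖z‖∞ > n ≥ 1`,
  `|Σ' c·H(z+x−y)| ≤ (K₈ + K₀)/‖z‖∞^{a+2}·(e^{−(m/n)‖z‖∞}(1+‖z‖∞/n)²)` — the `hfar` of `FarRegionMoment.shellBound_of_farShape ∕ sum_far_abs_le ∕ summable_moment` with
  `(C, δ, b) := (K₈ + K₀, m, 2)`;
* §2 **`sum_far_abs_le_of_graded`** (`a = 4`): `Σ_{z ∈ annulus 4 n R}|P z·z_μ·z_ν| ≤ 80·((K₈ + K₀)·(2!·e^{m/2}(2/m)²))·(1 + 2/m)` for every `R ≥ n`, n-FREE, and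
  `Summable (P·z_μ·z_ν)`, `P z := Σ' c·H(z+x−y)` — BY NAME over `FarRegionMoment`.
Provenance: leaf prover 06 (gen 32), 2026-08-21; no existing file touched.
-/

noncomputable section

namespace Summit.QuantumFields.BalabanUV.Beta.FP.FarRegionSmearShape

open Finset Filter Topology fwdDiff
open scoped BigOperators
open Literature.MathematicalPhysics.QuantumFieldTheory.Balaban1983to89
open Literature.MathematicalPhysics.QuantumFieldTheory.Balaban1983to89.Beta
open B12Sec2to5 (l1 l1_nonneg abs_coord_le_l1)
open ExpKernelCalculus (Site Zl Zl_pos)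
open DyadicShell (Pt supNorm)
open Summit.QuantumFields.BalabanUV.Beta.FP.ExpLocalisedBubble
open Summit.QuantumFields.BalabanUV.Beta.FP.FarRegionSmear
open Summit.QuantumFields.BalabanUV.Beta.FP.FarRegionSmearGraded

/-! ## §1 The core and the uniform far shape beyond the window (all `‖z‖∞ > n`): the input of `FarRegionMoment.shellBound_of_farShape` with `b = 2` -/

section Uniform

variable {c : Pt × Pt → ℝ} {H : Pt → ℝ} {C δ Ag A₀ A₁ A₂ η m : ℝ} {n a : ℕ}

/-- [folklore] THE CORE (`‖z‖∞ ≤ 8`): the trivial bound `|Σ' c·H(z+x−y)| ≤ Ag·C·Θ₀` in the shape currency, `Θ₀ := 2·(e^{δ/2})·e^{δ/2}·Zl(δ/2)²`: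
`≤ Ag·C·Θ₀·8^{a+2}·e^{8m} · (e^{−(m/n)‖z‖∞}(1+‖z‖∞/n)²/‖z‖∞^{a+2})` for `1 ≤ ‖z‖∞ ≤ 8`, `n ≥ 1`, `m ≥ 0`. -/
theorem abs_smear_le_core (hδ : 0 < δ)
    (hc : ∀ p : Pt × Pt, |c p| ≤ C * (Real.exp (-δ * l1 p.1) * Real.exp (-δ * l1 p.2)))
    (hg : ∀ t, |H t| ≤ Ag) (hn : 1 ≤ n) (hm : 0 ≤ m) {z : Pt} (hz1 : 1 ≤ supNorm z) (hz8 : supNorm z ≤ 8) (a : ℕ) :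
    |∑' p : Pt × Pt, c p * H (z + p.1 - p.2)|
      ≤ Ag * C * (2 ^ (0 + 1) * (((0 : ℕ).factorial : ℝ) * Real.exp (δ / 2) * (2 / δ) ^ 0) * Real.exp (δ / 2) * Zl 4 (δ / 2) ^ 2)
          * ((8 : ℝ) ^ (a + 2) * Real.exp (8 * m))
        * (Real.exp (-(m / n) * supNorm z) * (1 + (supNorm z : ℝ) / n) ^ 2 / (supNorm z : ℝ) ^ (a + 2)) := by
  have hC := nonneg_of_loc hc
  have hAg : 0 ≤ Ag := (abs_nonneg _).trans (hg z)
  have hn' : (1 : ℝ) ≤ n := by exact_mod_cast hn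
  have hs1 : (1 : ℝ) ≤ (supNorm z : ℝ) := by exact_mod_cast hz1
  have hs8 : (supNorm z : ℝ) ≤ 8 := by exact_mod_cast hz8
  have hs0 : (0 : ℝ) < supNorm z := by linarith
  set Θ₀ : ℝ := 2 ^ (0 + 1) * (((0 : ℕ).factorial : ℝ) * Real.exp (δ / 2) * (2 / δ) ^ 0) * Real.exp (δ / 2) * Zl 4 (δ / 2) ^ 2 with hΘ₀
  -- the trivial bound
  have h0 := tsum_loc_mul_pow_le hδ hc 0
  have hsm := summable_smear hδ hc hg z
  have htriv : |∑' p : Pt × Pt, c p * H (z + p.1 - p.2)| ≤ Ag * C * Θ₀ := by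
    have h1 : ∀ p : Pt × Pt, ‖c p * H (z + p.1 - p.2)‖ ≤ Ag * (|c p| * ((l1 p.1 + 1) + (l1 p.2 + 1)) ^ 0) := fun p => by
      rw [Real.norm_eq_abs, abs_mul, pow_zero, mul_one, mul_comm]
      exact mul_le_mul_of_nonneg_right (hg _) (abs_nonneg _)
    have hb := tsum_of_norm_bounded ((summable_loc_mul_pow hδ hc 0).hasSum.mul_left Ag) h1
    rw [Real.norm_eq_abs] at hb
    refine hb.trans ?_
    rw [mul_assoc]
    exact mul_le_mul_of_nonneg_left h0 hAg
  refine htriv.trans ?_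
  -- the shape factor is bounded below on the core
  have hΨ : 1 ≤ ((8 : ℝ) ^ (a + 2) * Real.exp (8 * m))
      * (Real.exp (-(m / n) * supNorm z) * (1 + (supNorm z : ℝ) / n) ^ 2 / (supNorm z : ℝ) ^ (a + 2)) := by
    have h1 : (supNorm z : ℝ) ^ (a + 2) ≤ (8 : ℝ) ^ (a + 2) := pow_le_pow_left₀ hs0.le hs8 _
    have h2 : 1 ≤ Real.exp (8 * m) * Real.exp (-(m / n) * supNorm z) := by
      rw [← Real.exp_add]
      refine Real.one_le_exp_iff.mpr ?_ |>.trans' le_rfl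
      have hmn : m / n ≤ m := div_le_self hm hn'
      have : m / n * (supNorm z : ℝ) ≤ m * 8 := mul_le_mul hmn hs8 hs0.le hm
      linarith
    have h3 : (1 : ℝ) ≤ (1 + (supNorm z : ℝ) / n) ^ 2 := one_le_pow₀ (by linarith [div_nonneg hs0.le (zero_le_one.trans hn')])
    have hs02 : 0 < (supNorm z : ℝ) ^ (a + 2) := by positivity
    rw [show ((8 : ℝ) ^ (a + 2) * Real.exp (8 * m)) * (Real.exp (-(m / n) * supNorm z) * (1 + (supNorm z : ℝ) / n) ^ 2 / (supNorm z : ℝ) ^ (a + 2))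
        = ((8 : ℝ) ^ (a + 2) / (supNorm z : ℝ) ^ (a + 2)) * ((Real.exp (8 * m) * Real.exp (-(m / n) * supNorm z)) * (1 + (supNorm z : ℝ) / n) ^ 2) by
          field_simp]
    have h4 : (1 : ℝ) ≤ (8 : ℝ) ^ (a + 2) / (supNorm z : ℝ) ^ (a + 2) := by rw [le_div_iff₀ hs02, one_mul]; exact h1
    calc (1 : ℝ) = 1 * (1 * 1) := by ring
      _ ≤ ((8 : ℝ) ^ (a + 2) / (supNorm z : ℝ) ^ (a + 2)) * ((Real.exp (8 * m) * Real.exp (-(m / n) * supNorm z)) * (1 + (supNorm z : ℝ) / n) ^ 2) :=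
          mul_le_mul h4 (mul_le_mul h2 h3 zero_le_one (by positivity)) (by positivity) (by positivity)
  calc Ag * C * Θ₀ = Ag * C * Θ₀ * 1 := (mul_one _).symm
    _ ≤ Ag * C * Θ₀ * (((8 : ℝ) ^ (a + 2) * Real.exp (8 * m))
          * (Real.exp (-(m / n) * supNorm z) * (1 + (supNorm z : ℝ) / n) ^ 2 / (supNorm z : ℝ) ^ (a + 2))) :=
        mul_le_mul_of_nonneg_left hΨ (by positivity)
    _ = _ := by ring

/-- [folklore] **THE UNIFORM GRADED FAR SHAPE BEYOND THE WINDOW** (RHOA-4 (b), smearing half): under the hypotheses of `abs_smear_le_of_graded_far`,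
for EVERY `z` with `‖z‖∞ > n` (`n ≥ 1`): `|Σ' c·H(z+x−y)| ≤ (K₈ + K₀)·(e^{−(m/n)‖z‖∞}(1+‖z‖∞/n)²/‖z‖∞^{a+2})`, `K₀ := Ag·C·Θ₀·8^{a+2}e^{8m}` — i.e.
`P := z ↦ Σ' c·H(z+x−y)` satisfies the hypothesis `hfar` of `FarRegionMoment.shellBound_of_farShape ∕ sum_far_abs_le` with `(C, δ, b) := (K₈ + K₀, m, 2)` (at `a = 4`). -/
theorem abs_smear_le_of_graded (hδ : 0 < δ)
    (hc : ∀ p : Pt × Pt, |c p| ≤ C * (Real.exp (-δ * l1 p.1) * Real.exp (-δ * l1 p.2)))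
    (hmass : ∑' p : Pt × Pt, c p = 0) (hmom : ∀ i, ∑' p : Pt × Pt, c p * ((p.1 - p.2) i : ℝ) = 0)
    (hg : ∀ t, |H t| ≤ Ag) (hn : 1 ≤ n) (hη : 0 < η) (hA0 : 0 ≤ A₀) (hA1 : 0 ≤ A₁) (hA2 : 0 ≤ A₂)
    (hG0 : ∀ t : Pt, 0 < supNorm t → |H t| ≤ A₀ / (supNorm t : ℝ) ^ a * Real.exp (-(η / n) * supNorm t))
    (hG1 : ∀ t : Pt, 0 < supNorm t → ∀ i, |Δ_[(Pi.single i 1 : Pt)] H t|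
      ≤ A₁ / (supNorm t : ℝ) ^ (a + 1) * (Real.exp (-(η / n) * supNorm t) * (1 + (supNorm t : ℝ) / n)))
    (hG2 : ∀ t : Pt, 0 < supNorm t → ∀ i j, |Δ_[(Pi.single i 1 : Pt)] (Δ_[(Pi.single j 1 : Pt)] H) t|
      ≤ A₂ / (supNorm t : ℝ) ^ (a + 2) * (Real.exp (-(η / n) * supNorm t) * (1 + (supNorm t : ℝ) / n) ^ 2))
    (hm : 0 < m) (hmη : m ≤ η / 2) (hmδ : m ≤ δ / 8) :
    ∀ z : Pt, n < supNorm z →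
      |∑' p : Pt × Pt, c p * H (z + p.1 - p.2)|
        ≤ ((C * (20 * (4 / 3 : ℝ) ^ (a + 2) * (25 / 16) * A₂ * (2 ^ (2 + 1) * (((2 : ℕ).factorial : ℝ) * Real.exp (δ / 2) * (2 / δ) ^ 2) * Real.exp (δ / 2) * Zl 4 (δ / 2) ^ 2)
              + 128 * 2 ^ a * A₀ * (2 ^ (2 + 1) * (((2 : ℕ).factorial : ℝ) * Real.exp (δ / 2) * (2 / δ) ^ 2) * Real.exp (δ / 2) * Zl 4 (δ / 2) ^ 2)
              + 64 * A₁ * (2 ^ (2 + 1 + 1) * (((2 + 1).factorial : ℝ) * Real.exp (δ / 2) * (2 / δ) ^ (2 + 1)) * Real.exp (δ / 2) * Zl 4 (δ / 2) ^ 2))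
            + Ag * C * Zl 4 (δ / 2) ^ 2 * (Real.exp (δ / 4) * (((a + 2).factorial : ℝ) * (8 / δ) ^ (a + 2))))
          + Ag * C * (2 ^ (0 + 1) * (((0 : ℕ).factorial : ℝ) * Real.exp (δ / 2) * (2 / δ) ^ 0) * Real.exp (δ / 2) * Zl 4 (δ / 2) ^ 2)
              * ((8 : ℝ) ^ (a + 2) * Real.exp (8 * m)))
          / (supNorm z : ℝ) ^ (a + 2) * (Real.exp (-(m / n) * supNorm z) * (1 + (supNorm z : ℝ) / n) ^ 2) := by
  intro z hz
  have hC := nonneg_of_loc hc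
  have hAg : 0 ≤ Ag := (abs_nonneg _).trans (hg z)
  have hZ : 0 < Zl 4 (δ / 2) := Zl_pos (half_pos hδ)
  have hs0 : (0 : ℝ) < supNorm z := by exact_mod_cast (show 0 < supNorm z by omega)
  -- both constants are nonnegative, so either case bound implies the sum bound
  set K₈ : ℝ := C * (20 * (4 / 3 : ℝ) ^ (a + 2) * (25 / 16) * A₂ * (2 ^ (2 + 1) * (((2 : ℕ).factorial : ℝ) * Real.exp (δ / 2) * (2 / δ) ^ 2) * Real.exp (δ / 2) * Zl 4 (δ / 2) ^ 2)
              + 128 * 2 ^ a * A₀ * (2 ^ (2 + 1) * (((2 : ℕ).factorial : ℝ) * Real.exp (δ / 2) * (2 / δ) ^ 2) * Real.exp (δ / 2) * Zl 4 (δ / 2) ^ 2)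
              + 64 * A₁ * (2 ^ (2 + 1 + 1) * (((2 + 1).factorial : ℝ) * Real.exp (δ / 2) * (2 / δ) ^ (2 + 1)) * Real.exp (δ / 2) * Zl 4 (δ / 2) ^ 2))
            + Ag * C * Zl 4 (δ / 2) ^ 2 * (Real.exp (δ / 4) * (((a + 2).factorial : ℝ) * (8 / δ) ^ (a + 2))) with hK₈
  set K₀ : ℝ := Ag * C * (2 ^ (0 + 1) * (((0 : ℕ).factorial : ℝ) * Real.exp (δ / 2) * (2 / δ) ^ 0) * Real.exp (δ / 2) * Zl 4 (δ / 2) ^ 2)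
              * ((8 : ℝ) ^ (a + 2) * Real.exp (8 * m)) with hK₀
  set Ψ : ℝ := Real.exp (-(m / n) * supNorm z) * (1 + (supNorm z : ℝ) / n) ^ 2 / (supNorm z : ℝ) ^ (a + 2) with hΨ
  have hK₈0 : 0 ≤ K₈ := by positivity
  have hK₀0 : 0 ≤ K₀ := by positivity
  have hΨ0 : 0 ≤ Ψ := by positivity
  have e : (K₈ + K₀) / (supNorm z : ℝ) ^ (a + 2) * (Real.exp (-(m / n) * supNorm z) * (1 + (supNorm z : ℝ) / n) ^ 2) = (K₈ + K₀) * Ψ := by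
    rw [hΨ]; ring
  rw [e]
  by_cases h8 : 8 ≤ supNorm z
  · have h := abs_smear_le_of_graded_far hδ hc hmass hmom hg hn hη hA0 hA1 hA2 hG0 hG1 hG2 hm hmη hmδ h8
    calc _ ≤ K₈ * Ψ := h
      _ ≤ (K₈ + K₀) * Ψ := mul_le_mul_of_nonneg_right (le_add_of_nonneg_right hK₀0) hΨ0
  · have h := abs_smear_le_core (z := z) hδ hc hg hn hm.le (by omega) (by omega) a
    calc _ ≤ K₀ * Ψ := h
      _ ≤ (K₈ + K₀) * Ψ := mul_le_mul_of_nonneg_right (le_add_of_nonneg_left hK₈0) hΨ0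

end Uniform

/-! ## §2 RHOA-4 (b), smearing half — chained with `FP/FarRegionMoment` at `a = 4` (two degree-2 legs): the n-FREE far second moment -/

section Chain

open Literature.Probability.LatticeModels (annulus)
open Summit.QuantumFields.BalabanUV.Beta.FP.FarRegionMoment (sum_far_abs_le summable_moment)

variable {c : Pt × Pt → ℝ} {H : Pt → ℝ} {C δ Ag A₀ A₁ A₂ η m : ℝ} {n : ℕ}

/-- [folklore] **THE n-FREE FAR SECOND MOMENT OF A SMEARED GRADED KERNEL** (`a = 4`): under the hypotheses of `abs_smear_le_of_graded` at `a = 4`,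
for `P z := Σ' c·H(z+x−y)`: `Σ_{z ∈ annulus 4 n R}|P z·z_μ·z_ν| ≤ 80·((K₈ + K₀)·(2!·e^{m/2}·(2/m)²))·(1 + 2/m)` for every `R ≥ n` — `FarRegionMoment.sum_far_abs_le`
BY NAME with `(C, δ, b) := (K₈ + K₀, m, 2)`; and `Summable (P·z_μ·z_ν)` (`FarRegionMoment.summable_moment`). -/
theorem sum_far_abs_le_of_graded (hδ : 0 < δ)
    (hc : ∀ p : Pt × Pt, |c p| ≤ C * (Real.exp (-δ * l1 p.1) * Real.exp (-δ * l1 p.2)))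
    (hmass : ∑' p : Pt × Pt, c p = 0) (hmom : ∀ i, ∑' p : Pt × Pt, c p * ((p.1 - p.2) i : ℝ) = 0)
    (hg : ∀ t, |H t| ≤ Ag) (hn : 1 ≤ n) (hη : 0 < η) (hA0 : 0 ≤ A₀) (hA1 : 0 ≤ A₁) (hA2 : 0 ≤ A₂)
    (hG0 : ∀ t : Pt, 0 < supNorm t → |H t| ≤ A₀ / (supNorm t : ℝ) ^ 4 * Real.exp (-(η / n) * supNorm t))
    (hG1 : ∀ t : Pt, 0 < supNorm t → ∀ i, |Δ_[(Pi.single i 1 : Pt)] H t|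
      ≤ A₁ / (supNorm t : ℝ) ^ (4 + 1) * (Real.exp (-(η / n) * supNorm t) * (1 + (supNorm t : ℝ) / n)))
    (hG2 : ∀ t : Pt, 0 < supNorm t → ∀ i j, |Δ_[(Pi.single i 1 : Pt)] (Δ_[(Pi.single j 1 : Pt)] H) t|
      ≤ A₂ / (supNorm t : ℝ) ^ (4 + 2) * (Real.exp (-(η / n) * supNorm t) * (1 + (supNorm t : ℝ) / n) ^ 2))
    (hm : 0 < m) (hmη : m ≤ η / 2) (hmδ : m ≤ δ / 8) (μ ν : Fin 4) :
    (∀ R : ℕ, n ≤ R →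
      ∑ z ∈ annulus 4 n R, |(∑' p : Pt × Pt, c p * H (z + p.1 - p.2)) * (z μ : ℝ) * (z ν : ℝ)|
        ≤ 80 * (((C * (20 * (4 / 3 : ℝ) ^ (4 + 2) * (25 / 16) * A₂ * (2 ^ (2 + 1) * (((2 : ℕ).factorial : ℝ) * Real.exp (δ / 2) * (2 / δ) ^ 2) * Real.exp (δ / 2) * Zl 4 (δ / 2) ^ 2)
              + 128 * 2 ^ 4 * A₀ * (2 ^ (2 + 1) * (((2 : ℕ).factorial : ℝ) * Real.exp (δ / 2) * (2 / δ) ^ 2) * Real.exp (δ / 2) * Zl 4 (δ / 2) ^ 2)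
              + 64 * A₁ * (2 ^ (2 + 1 + 1) * (((2 + 1).factorial : ℝ) * Real.exp (δ / 2) * (2 / δ) ^ (2 + 1)) * Real.exp (δ / 2) * Zl 4 (δ / 2) ^ 2))
            + Ag * C * Zl 4 (δ / 2) ^ 2 * (Real.exp (δ / 4) * (((4 + 2).factorial : ℝ) * (8 / δ) ^ (4 + 2))))
          + Ag * C * (2 ^ (0 + 1) * (((0 : ℕ).factorial : ℝ) * Real.exp (δ / 2) * (2 / δ) ^ 0) * Real.exp (δ / 2) * Zl 4 (δ / 2) ^ 2)
              * ((8 : ℝ) ^ (4 + 2) * Real.exp (8 * m)))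
          * (((2 : ℕ).factorial : ℝ) * Real.exp (m / 2) * (2 / m) ^ 2)) * (1 + 2 / m))
    ∧ Summable fun z : Pt => (∑' p : Pt × Pt, c p * H (z + p.1 - p.2)) * (z μ : ℝ) * (z ν : ℝ) := by
  have hC := nonneg_of_loc hc
  have hAg : 0 ≤ Ag := (abs_nonneg _).trans (hg 0)
  have hZ : 0 < Zl 4 (δ / 2) := Zl_pos (half_pos hδ)
  have hfar := abs_smear_le_of_graded (a := 4) hδ hc hmass hmom hg hn hη hA0 hA1 hA2 hG0 hG1 hG2 hm hmη hmδ
  have hK : 0 ≤ (C * (20 * (4 / 3 : ℝ) ^ (4 + 2) * (25 / 16) * A₂ * (2 ^ (2 + 1) * (((2 : ℕ).factorial : ℝ) * Real.exp (δ / 2) * (2 / δ) ^ 2) * Real.exp (δ / 2) * Zl 4 (δ / 2) ^ 2)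
              + 128 * 2 ^ 4 * A₀ * (2 ^ (2 + 1) * (((2 : ℕ).factorial : ℝ) * Real.exp (δ / 2) * (2 / δ) ^ 2) * Real.exp (δ / 2) * Zl 4 (δ / 2) ^ 2)
              + 64 * A₁ * (2 ^ (2 + 1 + 1) * (((2 + 1).factorial : ℝ) * Real.exp (δ / 2) * (2 / δ) ^ (2 + 1)) * Real.exp (δ / 2) * Zl 4 (δ / 2) ^ 2))
            + Ag * C * Zl 4 (δ / 2) ^ 2 * (Real.exp (δ / 4) * (((4 + 2).factorial : ℝ) * (8 / δ) ^ (4 + 2))))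
          + Ag * C * (2 ^ (0 + 1) * (((0 : ℕ).factorial : ℝ) * Real.exp (δ / 2) * (2 / δ) ^ 0) * Real.exp (δ / 2) * Zl 4 (δ / 2) ^ 2)
              * ((8 : ℝ) ^ (4 + 2) * Real.exp (8 * m)) := by positivity
  exact ⟨fun R hR => sum_far_abs_le (P := fun z => ∑' p : Pt × Pt, c p * H (z + p.1 - p.2)) hK hm hn hfar μ ν hR,
    summable_moment (P := fun z => ∑' p : Pt × Pt, c p * H (z + p.1 - p.2)) hK hm hn hfar μ ν⟩

end Chain

end Summit.QuantumFields.BalabanUV.Beta.FP.FarRegionSmearShape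

end
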